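/- Copyright: the b2b-balaban cell (near-miss cell 7), T⁴-continuum fan-out, ROUND-2 swarm of lineage t4-ne7b-p1
(node U5c COUNT member), seat t4-ne7b-formalise-leaf-08 (gen 7).  Released under the licence of the surrounding project. -/
import Summits.QuantumFields.BalabanUV.T4Continuum.Support.HistoryConstantsSlackT3b
import Summits.QuantumFields.BalabanUV.T4Continuum.Support.HistoryFlowProfileLevel

/-!
# History constants: THE CONSTANTS-SIDE CENSUS AFTER THE REPAIR — END v3.1's bundle is inhabited for EVERY positive
# print record, inside a coupling window (companion of `HistoryConstantsSlackT3b`, row S12k × repair row S12j)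

Summits-side support leaf of the T⁴-continuum cell (rung (B)+1 on a FINITE torus only; NOT infinite volume, NOT the
mass gap, NOT the Clay statement; NOT a proof of the spine estimate NE7b).  Claim table
`t4/b2b-balaban-t4-ne7b-p1/LEAVES-NE7b.md`, rows S12k (census, leaf-08 g7) and S12j (repair «THRESHOLD-PAID MULTIPLICITY»,
R-OWNER-23-10: (a) `HistoryAssemblyMultProfile`, (e) `HistoryFlowProfileLevel`).

WHY.  `HistoryConstantsSlackT3b` is the BEFORE column of the census: END v3 AS HOMED (θ slack-paid at the profile floor)
demands `8·8710^d < ½γ₀A₁²` of print's constants (finding F-leaf08g7-1).  The repair S12j re-homes the class-linear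
constant on the profile at a LEVEL `P`: the constants side of the repaired END reads {`ThresholdOK`, `0 ≤ θ`,
`hslack : a + θ ≤ ½γ₀A₁²`, `1 ≤ P`, `hθJ : ΘJ(d,sS,θc) + 8·2^d·log(2d+1) ≤ θ·P`, the stride∕decay arithmetic} plus the
ONE run-dependent display `hP : ∀ K ≥ K₀, ∀ s ≤ K, P ≤ p₀(g_K(s))`.  THIS FILE is the AFTER column, in the kernel: for
EVERY positive print record `O` that whole bundle is inhabited — the `C`-side by ONE print-dominating record
(`HistoryConstantsSlackT3b.exists_consts_END3` at the slack `θ := ¼γ₀A₁²`), the stride∕decay by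
`HistoryConstantsSlackT3b.exists_stride_decay`, the level by `HistoryFlowProfileLevel.le_theta_mul_level`, and `hP` along
EVERY run tuned inside the window `γ ≤ e^{−x∕2}` (`HistoryFlowProfileLevel.hP_of_window`).  Demand left on print's
`γ₀, A₁, o80, …`: NONE beyond positivity; the price is a smaller coupling window — the `ForSmallCouplings` prefix.

WHAT ([folklore] composition BY NAME of the two rows' lemmas; NO definition, no `Prop` fact, nothing printed asserted;
the `hθJ` left side pasted VERBATIM from END v3 p222172 with `θ ↦ θ·P` as ruled in R-OWNER-23-10 (2)(c)):
* §1 **`END3P_consts_of_pos`** — `O.Pos`, any `d`, `2 ≤ L`, `rr`: `∃ C β₀ θ x sS θc` with `ThresholdOK C L rr β₀`,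
  `Dominates C O`, `0 < μ`, `κ₁`-∕`E₀`-largeness, `1 ≤ A₀`, `13 ≤ n₁`, `0 < E₂`, `0 ≤ E₃`, `0 < β₀`, `L·β₀ ≤ 1`,
  `0 < θ`, `hslack`, `hsS`, `hsmall`, `hθc0`, `hθc1`, `hθcs`, `1 ≤ x`, `1 ≤ P` and `hθJ ≤ θ·P` at `P := C.A₀·x^{C.p₀}`.
* §2 **`END3P_consts_window`** — the same for the refinement factor `F.L` of a torus family, TOGETHER WITH the window:
  `0 < e^{−x∕2}` and, for every datum `D : FiniteEpsData F G` and every run tuned with `γ ≤ e^{−x∕2}`, the display `hP`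
  verbatim at that `P`.

HONEST.  Satisfiability bookkeeping of OUR END's constants side; discharges nothing of H3 ∕ (B) ∕ BetaPertH ∕ NE7c ∕ NE7
(the nine estimates sit in the term-data binders, untouched); NE7b NOT proved; spine 0∕9.  HONEST DEPENDENCY (cell):
continuum YM on T⁴ ⇐ BetaPertH ∧ nine spine estimates (0/9 proved); BetaPertH ⇐ (D1) ∧ (D4) ∧ CAP+tail; G-an2-4 gates
asym, D1 and NE2/3/4. -/

open Literature.MathematicalPhysics.QuantumFieldTheory.Balaban1983to89
open T4PersistenceDictionary T4PrintedShapeBanking T4CanonicalMenus T4Continuum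
open Summit.QuantumFields.BalabanUV.T4Continuum.CountThresholdUniform
open Summit.QuantumFields.BalabanUV.T4Continuum.HistoryConstants
open Summit.QuantumFields.BalabanUV.T4Continuum.HistoryFlow (two_le_L)
open Summit.QuantumFields.BalabanUV.T4Continuum.HistoryConstantsSlackT3b
open Summit.QuantumFields.BalabanUV.T4Continuum.HistoryFlowProfileLevel
open Summit.QuantumFields.BalabanUV.T4Continuum.HistoryZoneEvolve (cth)

namespace Summit.QuantumFields.BalabanUV.T4Continuum.HistoryConstantsSlackT3bP

noncomputable section

/-! ## §1 Every positive print record inhabits the repaired constants-side bundle -/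

section Pos

variable {O : PrintedO1s}

/-- **THE AFTER COLUMN**: for EVERY positive print record `O`, every dimension `d`, refinement factor `L ≥ 2` and size
exponent `rr`, the constants side of the REPAIRED END (R-OWNER-23-10 (2)(c): `hθJ` against `θ·P`) is inhabited: a
print-dominating record `C` meeting every `C`-side binder of the END and of the apex, `β₀ := 1∕L`, the positive slack
`θ := ¼γ₀A₁²`, an admissible stride∕decay `(sS, θc)`, and a level `x ≥ 1` with `P := C.A₀·x^{C.p₀} ≥ 1` carrying the
whole class-linear constant: `ΘJ(d,sS,θc) + 8·2^d·log(2d+1) ≤ θ·P`.  No inequality on print's constants beyond `O.Pos`.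
[folklore] -/
theorem END3P_consts_of_pos (hO : O.Pos) (d : ℕ) {L : ℕ} (hL : 2 ≤ L) (rr : ℕ) :
    ∃ (C : T4PrintedShapeBanking.Consts) (β₀ θ x : ℝ) (sS : ℕ) (θc : ℝ),
      ThresholdOK C L rr β₀ ∧ Dominates C O ∧ 0 < C.μ ∧
      (d : ℝ) * Real.log L + 2 * Real.log 2 ≤ C.κ₁ ∧ Real.log (2 + birthMass C) ≤ C.E₀ ∧ 1 ≤ C.A₀ ∧ 13 ≤ C.n₁ ∧
      0 < C.E₂ ∧ 0 ≤ C.E₃ ∧ 0 < β₀ ∧ (L : ℝ) * β₀ ≤ 1 ∧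
      0 < θ ∧ C.a + θ ≤ O.γ₀ * O.A₁ ^ 2 / 2 ∧
      1 ≤ sS ∧
      (((2 * cth 32 1 sS + 1) ^ d : ℕ) : ℝ) * (5 : ℝ) ^ d * ((max 1 (2 * 32 + 2) : ℕ) : ℝ) ≤ (L : ℝ) ^ (sS / 2) / 2 ∧
      0 ≤ θc ∧ θc < 1 ∧ 1 / 2 ≤ θc ^ sS ∧
      1 ≤ x ∧ 1 ≤ C.A₀ * x ^ C.p₀ ∧
      (2 +
            ((2 * (((2 * cth 32 1 sS + 1) ^ d : ℕ) : ℝ) * ((((2 * 32 + 1) ^ d : ℕ) : ℝ) * (4 * 2 ^ d)) +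
                  4 * ((((2 * cth 32 1 sS + 1) ^ d : ℕ) : ℝ) * (5 : ℝ) ^ d)) / (1 - θc) +
              2 * (2 * ((((2 * cth 32 1 sS + 1) ^ d : ℕ) : ℝ) * (5 : ℝ) ^ d))) +
            (2 * ((0 + 2 * Real.log (2 * d + 1)) + (2 * (d : ℝ) + 2 * Real.log (2 * d + 1)) *
                  (((max 1 (2 * 32 + 2) : ℕ) : ℝ) * (2 * ((((2 * cth 32 1 sS + 1) ^ d : ℕ) : ℝ) * (5 : ℝ) ^ d)))) +
              (2 * (d : ℝ) + 2 * Real.log (2 * d + 1)) * 1 *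
                (((max 1 (2 * 32 + 2) : ℕ) : ℝ) *
                    ((2 * (((2 * cth 32 1 sS + 1) ^ d : ℕ) : ℝ) * ((((2 * 32 + 1) ^ d : ℕ) : ℝ) * (4 * 2 ^ d)) +
                        4 * ((((2 * cth 32 1 sS + 1) ^ d : ℕ) : ℝ) * (5 : ℝ) ^ d)) / (1 - θc)) +
                  4 * 2 ^ d)) +
            10) + 8 * 2 ^ d * Real.log (2 * d + 1) ≤ θ * (C.A₀ * x ^ C.p₀) := by
  -- the slack: a quarter of print's constant
  have hγA : 0 < O.γ₀ * O.A₁ ^ 2 / 2 := by have := hO.γ₀_pos; have := hO.A₁_pos; positivity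
  have hθ : 0 < O.γ₀ * O.A₁ ^ 2 / 4 := by linarith
  have hθlt : O.γ₀ * O.A₁ ^ 2 / 4 < O.γ₀ * O.A₁ ^ 2 / 2 := by linarith
  obtain ⟨C, β₀, hT, hD, hμ, hκ₁, hE₀, hA₀, hn₁, hE₂, hE₃, hslack, hβ₀, hLβ⟩ :=
    exists_consts_END3 hO hθ.le hθlt d (le_trans one_le_two hL) rr
  obtain ⟨sS, θc, hsS, hsmall, hθc0, hθc1, hθcs⟩ := exists_stride_decay d hL
  refine ⟨C, β₀, O.γ₀ * O.A₁ ^ 2 / 4, max 1 (_ / (O.γ₀ * O.A₁ ^ 2 / 4 * C.A₀)), sS, θc, hT, hD, hμ, hκ₁, hE₀, hA₀, hn₁,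
    hE₂, hE₃, hβ₀, hLβ, hθ, hslack, hsS, hsmall, hθc0, hθc1, hθcs, one_le_level _ _ _,
    one_le_levelP hA₀ (one_le_level _ _ _), le_theta_mul_level hθ hT.A₀_pos (one_le_p₀ hT) _⟩

end Pos

/-! ## §2 … together with the window carrying the display `hP` along every tuned run -/

section Window

variable {F : T4Family} {G : Type*} [GaugeGroup G] [MeasurableSpace G] [HaarData G]
variable {O : PrintedO1s}

/-- **THE AFTER COLUMN WITH THE WINDOW**: for EVERY positive print record `O`, every torus family `F` (refinement factor
`F.L ≥ 2`), `d`, `rr`: the constants side of the repaired END is inhabited as in `END3P_consts_of_pos`, AND there is a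
positive window `γ₁ := e^{−x∕2}` such that for EVERY datum `D : FiniteEpsData F G` and EVERY run tuned with `γ ≤ γ₁` the
run-dependent display `hP : ∀ K ≥ K₀, ∀ s ≤ K, P ≤ p0Profile C.A₀ C.p₀ (g_K(s))` holds at the same `P`
(`HistoryFlowProfileLevel.hP_of_window`).  The demand of F-leaf08g7-1 has left print's constants for the
`ForSmallCouplings` prefix. [folklore] -/
theorem END3P_consts_window (hO : O.Pos) (F : T4Family) (d rr : ℕ) :
    ∃ (C : T4PrintedShapeBanking.Consts) (β₀ θ x : ℝ) (sS : ℕ) (θc : ℝ),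
      ThresholdOK C F.L rr β₀ ∧ Dominates C O ∧ 0 < C.μ ∧
      (d : ℝ) * Real.log F.L + 2 * Real.log 2 ≤ C.κ₁ ∧ Real.log (2 + birthMass C) ≤ C.E₀ ∧ 1 ≤ C.A₀ ∧ 13 ≤ C.n₁ ∧
      0 < C.E₂ ∧ 0 ≤ C.E₃ ∧ 0 < β₀ ∧ (F.L : ℝ) * β₀ ≤ 1 ∧
      0 < θ ∧ C.a + θ ≤ O.γ₀ * O.A₁ ^ 2 / 2 ∧
      1 ≤ sS ∧
      (((2 * cth 32 1 sS + 1) ^ d : ℕ) : ℝ) * (5 : ℝ) ^ d * ((max 1 (2 * 32 + 2) : ℕ) : ℝ) ≤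
          (F.L : ℝ) ^ (sS / 2) / 2 ∧
      0 ≤ θc ∧ θc < 1 ∧ 1 / 2 ≤ θc ^ sS ∧
      1 ≤ x ∧ 1 ≤ C.A₀ * x ^ C.p₀ ∧
      (2 +
            ((2 * (((2 * cth 32 1 sS + 1) ^ d : ℕ) : ℝ) * ((((2 * 32 + 1) ^ d : ℕ) : ℝ) * (4 * 2 ^ d)) +
                  4 * ((((2 * cth 32 1 sS + 1) ^ d : ℕ) : ℝ) * (5 : ℝ) ^ d)) / (1 - θc) +
              2 * (2 * ((((2 * cth 32 1 sS + 1) ^ d : ℕ) : ℝ) * (5 : ℝ) ^ d))) +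
            (2 * ((0 + 2 * Real.log (2 * d + 1)) + (2 * (d : ℝ) + 2 * Real.log (2 * d + 1)) *
                  (((max 1 (2 * 32 + 2) : ℕ) : ℝ) * (2 * ((((2 * cth 32 1 sS + 1) ^ d : ℕ) : ℝ) * (5 : ℝ) ^ d)))) +
              (2 * (d : ℝ) + 2 * Real.log (2 * d + 1)) * 1 *
                (((max 1 (2 * 32 + 2) : ℕ) : ℝ) *
                    ((2 * (((2 * cth 32 1 sS + 1) ^ d : ℕ) : ℝ) * ((((2 * 32 + 1) ^ d : ℕ) : ℝ) * (4 * 2 ^ d)) +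
                        4 * ((((2 * cth 32 1 sS + 1) ^ d : ℕ) : ℝ) * (5 : ℝ) ^ d)) / (1 - θc)) +
                  4 * 2 ^ d)) +
            10) + 8 * 2 ^ d * Real.log (2 * d + 1) ≤ θ * (C.A₀ * x ^ C.p₀) ∧
      0 < Real.exp (-(x / 2)) ∧
      ∀ (D : FiniteEpsData F G) (γ g : ℝ) (g₀ : ℕ → ℝ), D.Tuned γ g g₀ → γ ≤ Real.exp (-(x / 2)) →
        ∀ K₀ K : ℕ, K₀ ≤ K → ∀ s ≤ K, C.A₀ * x ^ C.p₀ ≤ p0Profile C.A₀ C.p₀ ((D.C ⟨K, F.m, g₀ K⟩).flow.g s) := by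
  obtain ⟨C, β₀, θ, x, sS, θc, hT, hD, hμ, hκ₁, hE₀, hA₀, hn₁, hE₂, hE₃, hβ₀, hLβ, hθ, hslack, hsS, hsmall, hθc0, hθc1,
    hθcs, hx, hP1, hθJ⟩ := END3P_consts_of_pos hO d (two_le_L F) rr
  exact ⟨C, β₀, θ, x, sS, θc, hT, hD, hμ, hκ₁, hE₀, hA₀, hn₁, hE₂, hE₃, hβ₀, hLβ, hθ, hslack, hsS, hsmall, hθc0, hθc1,
    hθcs, hx, hP1, hθJ, Real.exp_pos _,
    fun D _ _ _ ht hγ K₀ => hP_of_window D hT ht (zero_le_one.trans hx) hγ K₀⟩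

end Window


/-! ## §3 (v1.1, append-only) The BEFORE column as ONE bundle: every constants-side binder of END v3′ at once -/

section Full

variable {O : PrintedO1s}

/-- **THE FULL CONSTANTS-SIDE BUNDLE OF END v3 ∕ v3′ AS HOMED, IN ONE EXISTENTIAL** (closes leaf-10 g7's XREAD INFO I2 on
`HistoryConstantsSlackT3b.END3_consts_iff`): for `O.Pos`, `1 ≤ L`, the binders the headline of record (T3b form,
`HistoryRealiseCellsRunHeadlineT3b.continuumYM4Torus_of_countRoadT3b_fsc`, p223402) asks of `(C, β₀, θ, sS, θc)` —
`ThresholdOK`, `0 < μ`, `κ₁`-∕`E₀`-largeness, `1 ≤ A₀`, `0 < β₀`, `L·β₀ ≤ 1`, `13 ≤ n₁`, `0 ≤ θ`, `hslack`, `0 < E₂`,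
`0 ≤ E₃`, `hsS`, `hsmall`, `hθc0`, `hθc1`, `hθcs`, `hθJ` (verbatim) — have a common witness IFF print's `½γ₀A₁²` exceeds
the count's class-linear constant for some admissible stride∕decay.  With `HistoryConstantsSlackT3b.theta_floor` the
right side forces `8·8710^d < ½γ₀A₁²`: the BEFORE column.  (`Dominates C O` can be added on the left for free —
`HistoryConstantsSlackT3b.exists_consts_END3` delivers it.) [folklore] -/
theorem END3_full_consts_iff (hO : O.Pos) (d : ℕ) {L : ℕ} (hL : 1 ≤ L) (rr : ℕ) :
    (∃ (C : T4PrintedShapeBanking.Consts) (β₀ θ : ℝ) (sS : ℕ) (θc : ℝ),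
      ThresholdOK C L rr β₀ ∧ 0 < C.μ ∧
      (d : ℝ) * Real.log L + 2 * Real.log 2 ≤ C.κ₁ ∧ Real.log (2 + birthMass C) ≤ C.E₀ ∧ 1 ≤ C.A₀ ∧
      0 < β₀ ∧ (L : ℝ) * β₀ ≤ 1 ∧ 13 ≤ C.n₁ ∧
      0 ≤ θ ∧ C.a + θ ≤ O.γ₀ * O.A₁ ^ 2 / 2 ∧ 0 < C.E₂ ∧ 0 ≤ C.E₃ ∧
      1 ≤ sS ∧ (((2 * cth 32 1 sS + 1) ^ d : ℕ) : ℝ) * (5 : ℝ) ^ d * ((max 1 (2 * 32 + 2) : ℕ) : ℝ) ≤ (L : ℝ) ^ (sS / 2) / 2 ∧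
      0 ≤ θc ∧ θc < 1 ∧ 1 / 2 ≤ θc ^ sS ∧
      (2 +
            ((2 * (((2 * cth 32 1 sS + 1) ^ d : ℕ) : ℝ) * ((((2 * 32 + 1) ^ d : ℕ) : ℝ) * (4 * 2 ^ d)) +
                  4 * ((((2 * cth 32 1 sS + 1) ^ d : ℕ) : ℝ) * (5 : ℝ) ^ d)) / (1 - θc) +
              2 * (2 * ((((2 * cth 32 1 sS + 1) ^ d : ℕ) : ℝ) * (5 : ℝ) ^ d))) +
            (2 * ((0 + 2 * Real.log (2 * d + 1)) + (2 * (d : ℝ) + 2 * Real.log (2 * d + 1)) *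
                  (((max 1 (2 * 32 + 2) : ℕ) : ℝ) * (2 * ((((2 * cth 32 1 sS + 1) ^ d : ℕ) : ℝ) * (5 : ℝ) ^ d)))) +
              (2 * (d : ℝ) + 2 * Real.log (2 * d + 1)) * 1 *
                (((max 1 (2 * 32 + 2) : ℕ) : ℝ) *
                    ((2 * (((2 * cth 32 1 sS + 1) ^ d : ℕ) : ℝ) * ((((2 * 32 + 1) ^ d : ℕ) : ℝ) * (4 * 2 ^ d)) +
                        4 * ((((2 * cth 32 1 sS + 1) ^ d : ℕ) : ℝ) * (5 : ℝ) ^ d)) / (1 - θc)) +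
                  4 * 2 ^ d)) +
            10) + 8 * 2 ^ d * Real.log (2 * d + 1) ≤ θ) ↔
    ∃ (θc : ℝ) (sS : ℕ), 1 ≤ sS ∧ (((2 * cth 32 1 sS + 1) ^ d : ℕ) : ℝ) * (5 : ℝ) ^ d * ((max 1 (2 * 32 + 2) : ℕ) : ℝ) ≤ (L : ℝ) ^ (sS / 2) / 2 ∧
      0 ≤ θc ∧ θc < 1 ∧ 1 / 2 ≤ θc ^ sS ∧
      (2 +
            ((2 * (((2 * cth 32 1 sS + 1) ^ d : ℕ) : ℝ) * ((((2 * 32 + 1) ^ d : ℕ) : ℝ) * (4 * 2 ^ d)) +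
                  4 * ((((2 * cth 32 1 sS + 1) ^ d : ℕ) : ℝ) * (5 : ℝ) ^ d)) / (1 - θc) +
              2 * (2 * ((((2 * cth 32 1 sS + 1) ^ d : ℕ) : ℝ) * (5 : ℝ) ^ d))) +
            (2 * ((0 + 2 * Real.log (2 * d + 1)) + (2 * (d : ℝ) + 2 * Real.log (2 * d + 1)) *
                  (((max 1 (2 * 32 + 2) : ℕ) : ℝ) * (2 * ((((2 * cth 32 1 sS + 1) ^ d : ℕ) : ℝ) * (5 : ℝ) ^ d)))) +
              (2 * (d : ℝ) + 2 * Real.log (2 * d + 1)) * 1 *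
                (((max 1 (2 * 32 + 2) : ℕ) : ℝ) *
                    ((2 * (((2 * cth 32 1 sS + 1) ^ d : ℕ) : ℝ) * ((((2 * 32 + 1) ^ d : ℕ) : ℝ) * (4 * 2 ^ d)) +
                        4 * ((((2 * cth 32 1 sS + 1) ^ d : ℕ) : ℝ) * (5 : ℝ) ^ d)) / (1 - θc)) +
                  4 * 2 ^ d)) +
            10) + 8 * 2 ^ d * Real.log (2 * d + 1) < O.γ₀ * O.A₁ ^ 2 / 2 := by
  constructor
  · rintro ⟨C, β₀, θ, sS, θc, h, -, -, -, -, -, -, -, -, hslack, -, -, hsS, hsmall, hθc0, hθc1, hθcs, hθJ⟩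
    exact ⟨θc, sS, hsS, hsmall, hθc0, hθc1, hθcs, demand_of_slack h hslack hθJ⟩
  · rintro ⟨θc, sS, hsS, hsmall, hθc0, hθc1, hθcs, hlt⟩
    have hfloor := theta_floor (d := d) (sS := sS) hθc0 hθc1 hsS le_rfl
    have hθ0 := le_trans (by positivity : (0 : ℝ) ≤ 8 * 8710 ^ d) hfloor
    obtain ⟨C, β₀, h, -, hμ, hκ₁, hE₀, hA₀, hn₁, hE₂, hE₃, hslack, hβ₀, hLβ⟩ := exists_consts_END3 hO hθ0 hlt d hL rr
    exact ⟨C, β₀, _, sS, θc, h, hμ, hκ₁, hE₀, hA₀, hβ₀, hLβ, hn₁, hθ0, hslack, hE₂, hE₃, hsS, hsmall, hθc0, hθc1, hθcs,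
      le_rfl⟩

/-- **BEFORE ∕ AFTER IN ONE LINE**: on print constants with `½γ₀A₁² ≤ 8·8710^d` the v3′ bundle is EMPTY while the
repaired bundle (§1) is INHABITED (`O.Pos`, `2 ≤ L`). [folklore] -/
theorem before_empty_after_inhabited (hO : O.Pos) (d : ℕ) {L : ℕ} (hL : 2 ≤ L) (rr : ℕ) (β₀' : ℝ)
    (hsmallO : O.γ₀ * O.A₁ ^ 2 / 2 ≤ (8 : ℝ) * 8710 ^ d) :
    (¬ ∃ (C : T4PrintedShapeBanking.Consts) (θ θc : ℝ) (sS : ℕ),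
      ThresholdOK C L rr β₀' ∧ C.a + θ ≤ O.γ₀ * O.A₁ ^ 2 / 2 ∧ 1 ≤ sS ∧ 0 ≤ θc ∧ θc < 1 ∧
      (2 +
            ((2 * (((2 * cth 32 1 sS + 1) ^ d : ℕ) : ℝ) * ((((2 * 32 + 1) ^ d : ℕ) : ℝ) * (4 * 2 ^ d)) +
                  4 * ((((2 * cth 32 1 sS + 1) ^ d : ℕ) : ℝ) * (5 : ℝ) ^ d)) / (1 - θc) +
              2 * (2 * ((((2 * cth 32 1 sS + 1) ^ d : ℕ) : ℝ) * (5 : ℝ) ^ d))) +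
            (2 * ((0 + 2 * Real.log (2 * d + 1)) + (2 * (d : ℝ) + 2 * Real.log (2 * d + 1)) *
                  (((max 1 (2 * 32 + 2) : ℕ) : ℝ) * (2 * ((((2 * cth 32 1 sS + 1) ^ d : ℕ) : ℝ) * (5 : ℝ) ^ d)))) +
              (2 * (d : ℝ) + 2 * Real.log (2 * d + 1)) * 1 *
                (((max 1 (2 * 32 + 2) : ℕ) : ℝ) *
                    ((2 * (((2 * cth 32 1 sS + 1) ^ d : ℕ) : ℝ) * ((((2 * 32 + 1) ^ d : ℕ) : ℝ) * (4 * 2 ^ d)) +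
                        4 * ((((2 * cth 32 1 sS + 1) ^ d : ℕ) : ℝ) * (5 : ℝ) ^ d)) / (1 - θc)) +
                  4 * 2 ^ d)) +
            10) + 8 * 2 ^ d * Real.log (2 * d + 1) ≤ θ) ∧
    ∃ (C : T4PrintedShapeBanking.Consts) (β₀ θ x : ℝ) (sS : ℕ) (θc : ℝ),
      ThresholdOK C L rr β₀ ∧ Dominates C O ∧ 0 < θ ∧ C.a + θ ≤ O.γ₀ * O.A₁ ^ 2 / 2 ∧ 1 ≤ sS ∧
      (((2 * cth 32 1 sS + 1) ^ d : ℕ) : ℝ) * (5 : ℝ) ^ d * ((max 1 (2 * 32 + 2) : ℕ) : ℝ) ≤ (L : ℝ) ^ (sS / 2) / 2 ∧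
      0 ≤ θc ∧ θc < 1 ∧ 1 / 2 ≤ θc ^ sS ∧ 1 ≤ x ∧ 1 ≤ C.A₀ * x ^ C.p₀ ∧
      (2 +
            ((2 * (((2 * cth 32 1 sS + 1) ^ d : ℕ) : ℝ) * ((((2 * 32 + 1) ^ d : ℕ) : ℝ) * (4 * 2 ^ d)) +
                  4 * ((((2 * cth 32 1 sS + 1) ^ d : ℕ) : ℝ) * (5 : ℝ) ^ d)) / (1 - θc) +
              2 * (2 * ((((2 * cth 32 1 sS + 1) ^ d : ℕ) : ℝ) * (5 : ℝ) ^ d))) +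
            (2 * ((0 + 2 * Real.log (2 * d + 1)) + (2 * (d : ℝ) + 2 * Real.log (2 * d + 1)) *
                  (((max 1 (2 * 32 + 2) : ℕ) : ℝ) * (2 * ((((2 * cth 32 1 sS + 1) ^ d : ℕ) : ℝ) * (5 : ℝ) ^ d)))) +
              (2 * (d : ℝ) + 2 * Real.log (2 * d + 1)) * 1 *
                (((max 1 (2 * 32 + 2) : ℕ) : ℝ) *
                    ((2 * (((2 * cth 32 1 sS + 1) ^ d : ℕ) : ℝ) * ((((2 * 32 + 1) ^ d : ℕ) : ℝ) * (4 * 2 ^ d)) +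
                        4 * ((((2 * cth 32 1 sS + 1) ^ d : ℕ) : ℝ) * (5 : ℝ) ^ d)) / (1 - θc)) +
                  4 * 2 ^ d)) +
            10) + 8 * 2 ^ d * Real.log (2 * d + 1) ≤ θ * (C.A₀ * x ^ C.p₀) := by
  refine ⟨not_exists_END3_consts_of_le hsmallO, ?_⟩
  obtain ⟨C, β₀, θ, x, sS, θc, hT, hD, -, -, -, -, -, -, -, -, -, hθ, hslack, hsS, hsmall, hθc0, hθc1, hθcs, hx, hP1,
    hθJ⟩ := END3P_consts_of_pos hO d hL rr
  exact ⟨C, β₀, θ, x, sS, θc, hT, hD, hθ, hslack, hsS, hsmall, hθc0, hθc1, hθcs, hx, hP1, hθJ⟩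

end Full

end

end Summit.QuantumFields.BalabanUV.T4Continuum.HistoryConstantsSlackT3bP
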